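import Summits.Ventures.HSemireg.SecantParityWeilTypeDiscriminant
import Summits.Ventures.HSemireg.SecantParityWeilTypePolarized
import Literature.Geometry.Kaehler.ComplexTorusEllipticCurveWeilPairing
import HarnessLib

/-!
# Venture HSemireg — [Mar25 Lemma 3.1.3] WITHOUT POSITIVITY: the printed PROOF needs no polarisation — the Hermitian form of
# Markman's `(X × X̂, K = ℚ(A), c·Ξ_d)` is defined for every secant direction `b = η` and every rational scalar `c ≠ 0`, and its
# discriminant is `(-1)^{dim X}` for EVERY complex torus `X` and EVERY non-degenerate `η ∈ NS(X)` (any index), a generalisation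
# DERIVED HERE from the printed computation (print states the lemma for the plane (2.4.5) of §2.4, `Θ` ample) —
# TRACK S4-PUSH (ii), seat `s4-prove-1` (g14);
# file XIIg (generality leaf of XIIe `SecantParityWeilTypeDiscriminant`), record `s4push/prove-1/ATTEMPT-17.md`

HONEST FRAMING. Lean index of the computation cell `pub-hsemireg`; OBJECT LEVEL as in files XII ∕ XIIb∕c ∕ XIId ∕
XIIe ∕ XIIf of this lane: the complex torus `X = E/Φ(ℤ^ι)`, a non-degenerate `η ∈ NS(X)` with integer Gram matrix `G`
on the lattice basis, Markman's rational endomorphism `A = (0 (ᵗG)⁻¹; -d·ᵗG 0)` of `X × X̂` (`A² = -d`, file XIIb∕c)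
and the block-diagonal rational matrices `Γ(a, c) = (a·G 0; 0 c·(ᵗG)⁻¹)` — for `a = c·d` and `c = ±N` these are
EXACTLY the rational Gram matrices of `N·(±Ξ_d)` on the lattice basis of `X × X̂` (file XIIe `map_ratCast_blockGram`,
`map_ratCast_blockGram_neg`). File XIIe typed [Mar25 Lemma 3.1.3] through the tree's `IsPolarizedWeilType.discriminant`,
whose carrier is a POLARISED complex torus of Weil type — by file XIId that structure exists iff `±η` is a Riemann
form, i.e. iff `±b` is a polarisation. IN PRINT, Lemma 3.1.3 is stated for the plane `P` of (2.4.5), which §2.4 builds from an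
AMPLE `Θ` — the polarised case, by reference (p. 20–23); but Markman's form `H` ((3.1.2) «`H(x,y) := d(x,y)_V + √-d(f(x),y)_V`»,
Lemma 3.1.2) is defined for every oriented `K`-secant plane under Assumption 2.4.1 («an oriented `K`-secant `P` … determines a
`Spin(V)_P`-invariant hermitian form on `V`, up to a rational scalar», p. 22), and the printed PROOF of Lemma 3.1.3 (p. 23:
«`det(Θ(y_i, y_j))` is the square of a rational number, since `Θ` is anti-symmetric») uses no positivity. THIS FILE derives that
generalisation from the printed computation — for every complex torus `X = E/Φ(ℤ^ι)` and every non-degenerate `η ∈ NS(X)`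
(Markman's §3 stands on an abelian variety with the `K`-secant plane of an ample `Θ`): proved, not transcribed (s4-ref VERDICT #5
P-2; lit-3 g58 (p1)(p2)) — in the tree's Hermitian layer (Literature `ComplexTorusWeilTypeHermitianForm`
§3–§5: `WeilHermitian.hermForm G α hc`, `WeilHermitian.discr`): (i) the compatibility `ᵗA Γ A = d Γ` making
`H_Γ(x, y) = Γ(x, A y) + √-d·Γ(x, y)` a Hermitian form holds for EVERY `η` and every `(a, c)` with `a = c·d`
(`weilMatrix_compat_blockGram` — pure matrix algebra, no positivity), `Γ` is alternating and non-degenerate for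
`c ≠ 0` (`transpose_blockGram`, `det_blockGram_ne_zero`); (ii) **`discr H_Γ = [(-1)^{dim_ℂ X}]` in `ℚˣ ⧸ Nm(Kˣ)` for
every `K`-basis** (`discr_hermForm_blockGram_weilMatrix`) — also for the INTERMEDIATE-INDEX secant directions of the
lane's (H1) desk (sheet S3INP-4's `E⁴` class, V-b's `η_s` with `0 < s < g`), where no `IsPolarizedWeilType` structure
exists for either orientation (XIId `hermIndex_Xi_eFour`) and XIIe is silent; (iii) consistency: whenever the polarised
structure `h` of XIIe DOES exist, its `h.discriminant` is this `discr` (`discriminant_eq_discr_hermForm`), so XIIe's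
`discriminant_smul_Xi` is the special case `±b` a polarisation; (iv) THE INTERMEDIATE-INDEX CASE IS INHABITED (§3): on `E_τ⁴` with
the lane's counter-model direction `η₄ = e₁ + e₂ + e₃ − e₄` (index `1`, `∫ η₄⁴ = −24`, file IVb; `Ξ_d` of index `2`, polarised for neither
orientation, XIId `hermIndex_Xi_eFour`) the hypotheses of `discr_hermForm_weilMatrix` are INHABITED where XIIe's are EMPTY, and
the discriminant is `[(-1)⁴] = 1` — a norm class — for every `d`, `c`, `α`, basis (`eFourGram_map_intCast`,
`discr_hermForm_weilMatrix_eFour`; at even `n` this is a constraint on `H`, not an invariant distinguishing the counter-model).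
Block core (§1, pure linear algebra over `K = ℚ(√-d)`):
`fromBlocks_transpose_mul_mul` (`ᵗα G α` for `α = (0 B; C 0)`, `G = (G₁ 0; 0 G₂)`) and `discr_hermForm_blockGram`
(`discr = [(-1)^k]` for `#ι = 2k`, `det C ≠ 0`, `det G₁` a non-zero square) — XIIe's `discriminant_eq_of_blockGram` with
the `IsPolarizedWeilType` wrapper removed; its ingredients `hermGram_single_inl`, `det_omega_smul_map_re`,
`mk_mk0_neg_pow_mul_sq`, `linearIndependent_single_inl`, `finrank_weilVec_sum` are IMPORTED from XIIe, not restated.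
READING for the cell (scope sentence, not a census claim): H1-FILTER-CARD F9 («split component only») now holds at
the level of the Hermitian `K`-space `(H₁(X × X̂, ℚ), H)` for every secant direction, polarising or not; it certifies no
object and moves no signed word ((S3) «PROVED given `∫bⁿ > 0`»; STRUCTURE D6 ∕ (S4)). Nothing here says that HC, HC_CM
or HC_AV holds. NO definition, NO named fact, NO sorry; theorems only. Imports XIIe (block core, hence XIIb∕c and the Literature
Hermitian layer), XIId (only for §3: `eq_zero_of_forall_eFour_apply_eq_zero` and file IVb's `η₄`) and Literature
`ComplexTorusEllipticCurveWeilPairing` (`ellipticGram`).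

## References
* [Markman2025SecantWeil] = [Mar25] E. Markman, *Cycles on abelian 2n-folds of Weil type from secant sheaves on
  abelian n-folds*, arXiv:2502.03415 (2025), v2: p. 22 («determines a `Spin(V)_P`-invariant hermitian form on `V`, up to a
  rational scalar … all have discriminat `(-1)^n`»; (3.1.1) = the group `SO₊(V_ℚ)_f`, (3.1.2) = the form `H`; Lemma 3.1.2 —
  no polarisation hypothesis), p. 23 §3.1 Lemma 3.1.3 («Assume that the similarity `f` … is defined in terms of the oriented
  plane `P` given in Equation (2.4.5). Then the discriminant of the hermitian form `H` is `(-1)ⁿ`.» — `P` from an ample `Θ`,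
  p. 20–21) with its proof (no positivity used); held text `paper:arxiv-2502.03415` chunks p0018–p0019.
* [Lange2023AbelianVarietiesComplex] H. Lange, *Abelian Varieties over the Complex Numbers* (2023), §7.3.3 Exercise
  (5)(a)(c) (the Hermitian form `H(x, y) = E(x, √-d·y) + √-d E(x, y)` and its discriminant), §1.5.3 (`det E = Pf(E)²`),
  §2.4.4 Cor. 2.4.24, §2.5.1 Prop. 2.5.1 (dual polarisation, Gram matrix `(ᵗG)⁻¹`).
* [vanGeemen1994HodgeAV] = [vG94] B. van Geemen, LNM 1594 (1994), Lemma 5.2 (2)(3).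
* Cell records: `s4push/prove-1/ATTEMPT-17.md` (g14; origin: `ATTEMPT-16.md` §8 GENERALITY NOTE, g13); sheet
  `STATEMENTS-S3INPUT.md` S3INP-17; `H1-FILTER-CARD.md` F9.
-/

noncomputable section

open Complex Module Matrix
open Literature.Geometry.Kaehler Literature.Geometry.Kaehler.ComplexTorus
open Literature.Geometry.Kaehler.ComplexTorus.WeilHermitian

namespace Summit.Ventures.HSemireg

namespace SecantParity

/-! ## §1 Block core: `ᵗα G α` and the discriminant for `α = (0 B; C 0)`, `G = (G₁ 0; 0 G₂)` — no positivity -/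

section BlockCore

variable {ι : Type*} [Fintype ι] [DecidableEq ι] {d : ℕ}
  (G₁ G₂ B C : Matrix ι ι ℚ) (α : SqrtNegMat (ι ⊕ ι) d) (hα : α.1 = Matrix.fromBlocks 0 B C 0)

omit [DecidableEq ι] in
/-- **`ᵗα G α = (ᵗC G₂ C 0; 0 ᵗB G₁ B)`** for `α = (0 B; C 0)` and block-diagonal `G = (G₁ 0; 0 G₂)`: the
compatibility `ᵗα G α = d G` of Exercise 7.2.4 (6) reduces to the two block identities `ᵗC G₂ C = d G₁`,
`ᵗB G₁ B = d G₂`. [cite: Lange2023AbelianVarietiesComplex, §7.2.4 Exercise (6)] -/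
theorem fromBlocks_transpose_mul_mul :
    (Matrix.fromBlocks (0 : Matrix ι ι ℚ) B C 0)ᵀ * Matrix.fromBlocks G₁ 0 0 G₂ * Matrix.fromBlocks 0 B C 0 =
      Matrix.fromBlocks (Cᵀ * G₂ * C) 0 0 (Bᵀ * G₁ * B) := by
  rw [Matrix.fromBlocks_transpose, Matrix.fromBlocks_multiply, Matrix.fromBlocks_multiply]
  simp only [Matrix.transpose_zero, Matrix.zero_mul, Matrix.mul_zero, zero_add, add_zero]

include hα in
/-- **The discriminant of `H` for `α = (0 B; C 0)`, `G = (G₁ 0; 0 G₂)` — NO POSITIVITY.** If `ᵗα G α = d G`, `G` is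
alternating and non-degenerate, `det C ≠ 0`, `#ι = 2k` and `det G₁ = r²` with `r ≠ 0`, then for EVERY `K`-basis `b`
of `(ℚ^{ι ⊔ ι}, α)` the discriminant of the Hermitian form `H(x, y) = G(x, αy) + √-d G(x, y)` is the class of `(-1)^k`
in `ℚˣ ⧸ Nm(Kˣ)`: computed in the `K`-basis of first-block vectors (XIIe `linearIndependent_single_inl`), where the
Gram matrix is `√-d · G₁` (XIIe `hermGram_single_inl`), `det = (-d)^k r²` and `[(-d)^k r²] = [(-1)^k]` (XIIe
`mk_mk0_neg_pow_mul_sq`); basis independence is the tree's `WeilHermitian.discr_eq_discr'`. Markman: «`det(H(…)) =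
(d√-d)^{2n} det(Θ(y_i,y_j)) = (-1)ⁿ d^{3n} det(Θ(y_i,y_j))` … Hence `det(H) Nm(Kˣ) = (-1)ⁿ Nm(Kˣ)`.»
[cite: Markman2025SecantWeil, §3.1 Lemma 3.1.3 (proof)] [cite: Lange2023AbelianVarietiesComplex, §7.3.3 Exercise (5)(c)]
[cite: vanGeemen1994HodgeAV, Lemma 5.2 (3)] -/
theorem discr_hermForm_blockGram [NeZero d]
    (hc : α.1ᵀ * Matrix.fromBlocks G₁ 0 0 G₂ * α.1 = (d : ℚ) • Matrix.fromBlocks G₁ 0 0 G₂)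
    (hGt : (Matrix.fromBlocks G₁ 0 0 G₂)ᵀ = -Matrix.fromBlocks G₁ 0 0 G₂)
    (hdet : (Matrix.fromBlocks G₁ 0 0 G₂).det ≠ 0) (hC : C.det ≠ 0) {k : ℕ} (hk : Fintype.card ι = 2 * k)
    {r : ℚ} (hr : r ≠ 0) (hG₁ : G₁.det = r ^ 2)
    {κ : Type*} [Fintype κ] [DecidableEq κ] (b : Module.Basis κ (RatSqrtNeg d) (WeilVec α)) :
    WeilHermitian.discr (isSymm_hermForm hc hGt) (nondegenerate_hermForm hc hdet).2 b =
      QuotientGroup.mk ((-1) ^ k) := by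
  have hli := linearIndependent_single_inl B C α hα hC
  have hfin : Fintype.card ι = finrank (RatSqrtNeg d) (WeilVec α) := (finrank_weilVec_sum α).symm
  obtain ⟨b₀, hb₀⟩ : ∃ b₀ : Module.Basis ι (RatSqrtNeg d) (WeilVec α),
      ⇑b₀ = fun i : ι ↦ (WeilVec.toVec α).symm (Pi.single (Sum.inl i) (1 : ℚ)) :=
    ⟨basisOfLinearIndependentOfCardEqFinrank' _ hli hfin, coe_basisOfLinearIndependentOfCardEqFinrank' _ hli hfin⟩
  rw [WeilHermitian.discr_eq_discr' _ _ b b₀]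
  unfold WeilHermitian.discr
  have hgram : hermGram (hermForm (Matrix.fromBlocks G₁ 0 0 G₂) α hc) b₀ =
      (QuadraticAlgebra.omega : RatSqrtNeg d) • G₁.map (Rat.cast : ℚ → RatSqrtNeg d) := by
    rw [hb₀]
    exact hermGram_single_inl G₁ G₂ B C α hα hc
  have hre : ((hermGram (hermForm (Matrix.fromBlocks G₁ 0 0 G₂) α hc) b₀).det).re = (-(d : ℚ)) ^ k * r ^ 2 := by
    rw [hgram, det_omega_smul_map_re hk, hG₁]
  have key : ∀ (x : ℚ) (hx : x ≠ 0), x = (-(d : ℚ)) ^ k * r ^ 2 →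
      (QuotientGroup.mk (Units.mk0 x hx) : ℚˣ ⧸ normUnits d) = QuotientGroup.mk ((-1) ^ k) := by
    intro x hx hxe
    subst hxe
    exact mk_mk0_neg_pow_mul_sq hr hx
  exact key _ _ hre

end BlockCore

/-! ## §2 Markman's `(X × X̂, A)` with the block matrices `Γ(a, c) = (a·G 0; 0 c·(ᵗG)⁻¹)`, `a = c·d` -/

section Markman

variable {ι : Type*} [Fintype ι] [DecidableEq ι] {E : Type*} [NormedAddCommGroup E] [NormedSpace ℂ E]
  (Φ : (ι → ℝ) ≃L[ℝ] E) {η : E [⋀^Fin 2]→L[ℝ] ℝ}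
  (hnd : ∀ u : E, (∀ v, η ![u, v] = 0) → u = 0) {G : Matrix ι ι ℤ} {d : ℕ}
  (α : SqrtNegMat (ι ⊕ ι) d)
  (hα : α.1 = Matrix.fromBlocks 0 (G.transpose.map (Int.cast : ℤ → ℚ))⁻¹ ((-(d : ℚ)) • G.transpose.map (Int.cast : ℤ → ℚ)) 0)

omit [Fintype ι] [DecidableEq ι] in
/-- `ℤ → ℚ → ℝ = ℤ → ℝ` on matrices. [folklore] -/
private theorem map_intCast_map_ratCast₃ {m n : Type*} (A : Matrix m n ℤ) :
    (A.map (Int.cast : ℤ → ℚ)).map (Rat.cast : ℚ → ℝ) = A.map (Int.cast : ℤ → ℝ) :=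
  Matrix.ext fun i j ↦ Rat.cast_intCast (A i j)

/-- `ᵗ(G_ℚ) = -G_ℚ`: the rational form of the integer Gram matrix of `η ∈ NS(X)` is alternating.
[cite: Lange2023AbelianVarietiesComplex, §1.5.1] -/
theorem transpose_map_intCast_gram (hG : G.map (Int.cast : ℤ → ℝ) = latticeGram Φ η) :
    (G.map (Int.cast : ℤ → ℚ))ᵀ = -G.map (Int.cast : ℤ → ℚ) :=
  transpose_eq_neg_of_map_ratCast Φ ((map_intCast_map_ratCast₃ G).trans hG)

omit [Fintype ι] [DecidableEq ι] in
/-- `ᵗ((ᵗG)_ℚ) = G_ℚ`. [folklore] -/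
private theorem transpose_transposeGram : (G.transpose.map (Int.cast : ℤ → ℚ))ᵀ = G.map (Int.cast : ℤ → ℚ) := by
  rw [Matrix.transpose_map, Matrix.transpose_transpose]

include hnd in
/-- `G_ℚ` is invertible (`η` non-degenerate). [cite: Lange2023AbelianVarietiesComplex, §2.4.4 Cor. 2.4.24] -/
theorem isUnit_det_map_intCast_gram (hG : G.map (Int.cast : ℤ → ℝ) = latticeGram Φ η) :
    IsUnit (G.map (Int.cast : ℤ → ℚ)).det := by
  have h := isUnit_det_transposeGram Φ hnd hG
  rwa [← transpose_transposeGram, Matrix.det_transpose]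

include hnd hα in
/-- **`ᵗA Γ A = d Γ` for EVERY `η`** (no positivity): Markman's `A = (0 (ᵗG)⁻¹; -d·ᵗG 0)` satisfies the Weil-type
compatibility of Exercise 7.2.4 (6) with `Γ(a, c) = (a·G 0; 0 c·(ᵗG)⁻¹)` as soon as `a = c·d` — the rational shadow of
`Ξ_P(f x, f y) = d·Ξ_P(x, y)` (file XII `Xi_weilOperator`), here by matrix algebra alone:
`ᵗ(-dᵗG)·(c(ᵗG)⁻¹)·(-dᵗG) = d²c·G` and `ᵗ((ᵗG)⁻¹)·(aG)·(ᵗG)⁻¹ = a·(ᵗG)⁻¹`.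
[cite: Markman2025SecantWeil, §2.4 (2.4.3) and §3.1 (3.1.2)] [cite: Lange2023AbelianVarietiesComplex, §7.2.4 Exercise (6)] -/
theorem weilMatrix_compat_blockGram (hG : G.map (Int.cast : ℤ → ℝ) = latticeGram Φ η) {a c : ℚ} (ha : a = c * d) :
    α.1ᵀ * Matrix.fromBlocks (a • G.map (Int.cast : ℤ → ℚ)) 0 0 (c • (G.transpose.map (Int.cast : ℤ → ℚ))⁻¹) * α.1 =
      (d : ℚ) • Matrix.fromBlocks (a • G.map (Int.cast : ℤ → ℚ)) 0 0 (c • (G.transpose.map (Int.cast : ℤ → ℚ))⁻¹) := by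
  have hT := isUnit_det_transposeGram Φ hnd hG
  have hGu := isUnit_det_map_intCast_gram Φ hnd hG
  rw [hα, fromBlocks_transpose_mul_mul, Matrix.fromBlocks_smul, smul_zero]
  congr 1
  · -- `ᵗ(-dᵗG)·(c(ᵗG)⁻¹)·(-dᵗG) = d·(a·G)`
    rw [Matrix.transpose_smul, transpose_transposeGram]
    simp only [Matrix.smul_mul, Matrix.mul_smul, smul_smul, Matrix.nonsing_inv_mul_cancel_right _ _ hT]
    rw [ha]
    congr 1
    ring
  · -- `ᵗ((ᵗG)⁻¹)·(aG)·(ᵗG)⁻¹ = d·(c·(ᵗG)⁻¹)`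
    rw [Matrix.transpose_nonsing_inv, transpose_transposeGram]
    simp only [Matrix.smul_mul, Matrix.mul_smul, smul_smul, Matrix.nonsing_inv_mul _ hGu, Matrix.one_mul]
    rw [ha, mul_comm c]

include hnd in
/-- **`Γ(a, c)` is alternating**: `ᵗΓ = -Γ` (from `ᵗG = -G` and `ᵗ((ᵗG)⁻¹) = G⁻¹ = -(ᵗG)⁻¹`).
[cite: Lange2023AbelianVarietiesComplex, §1.5.1 and §2.5.1 Prop. 2.5.1] -/
theorem transpose_blockGram (hG : G.map (Int.cast : ℤ → ℝ) = latticeGram Φ η) (a c : ℚ) :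
    (Matrix.fromBlocks (a • G.map (Int.cast : ℤ → ℚ)) 0 0 (c • (G.transpose.map (Int.cast : ℤ → ℚ))⁻¹))ᵀ =
      -Matrix.fromBlocks (a • G.map (Int.cast : ℤ → ℚ)) 0 0 (c • (G.transpose.map (Int.cast : ℤ → ℚ))⁻¹) := by
  have hGt := transpose_map_intCast_gram Φ hG
  have hT := isUnit_det_transposeGram Φ hnd hG
  -- `ᵗ((ᵗG)⁻¹) = -(ᵗG)⁻¹`: `-(ᵗG)⁻¹` is a right inverse of `ᵗ(ᵗG) = G = -ᵗG`
  have hGT : G.map (Int.cast : ℤ → ℚ) = -G.transpose.map (Int.cast : ℤ → ℚ) := by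
    rw [Matrix.transpose_map, hGt, neg_neg]
  have hinv : ((G.transpose.map (Int.cast : ℤ → ℚ))⁻¹)ᵀ = -(G.transpose.map (Int.cast : ℤ → ℚ))⁻¹ := by
    rw [Matrix.transpose_nonsing_inv, transpose_transposeGram]
    refine Matrix.inv_eq_right_inv ?_
    rw [hGT, Matrix.neg_mul, Matrix.mul_neg, neg_neg, Matrix.mul_nonsing_inv _ hT]
  rw [Matrix.fromBlocks_transpose, Matrix.fromBlocks_neg, Matrix.transpose_smul, Matrix.transpose_smul, hGt, hinv,
    Matrix.transpose_zero, smul_neg, smul_neg, neg_zero]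

include hnd in
/-- **`Γ(a, c)` is non-degenerate** for `a ≠ 0`, `c ≠ 0` (`det Γ = a^{#ι} det G · c^{#ι} det (ᵗG)⁻¹ ≠ 0`).
[cite: Lange2023AbelianVarietiesComplex, §2.4.4 Cor. 2.4.24] -/
theorem det_blockGram_ne_zero (hG : G.map (Int.cast : ℤ → ℝ) = latticeGram Φ η) {a c : ℚ} (ha : a ≠ 0)
    (hc : c ≠ 0) :
    (Matrix.fromBlocks (a • G.map (Int.cast : ℤ → ℚ)) 0 0 (c • (G.transpose.map (Int.cast : ℤ → ℚ))⁻¹)).det ≠ 0 := by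
  have hT := isUnit_det_transposeGram Φ hnd hG
  have hGu := isUnit_det_map_intCast_gram Φ hnd hG
  rw [Matrix.det_fromBlocks_zero₂₁, Matrix.det_smul, Matrix.det_smul]
  exact mul_ne_zero (mul_ne_zero (pow_ne_zero _ ha) hGu.ne_zero)
    (mul_ne_zero (pow_ne_zero _ hc) (Matrix.isUnit_nonsing_inv_det _ hT).ne_zero)

/-- `a = c·d ≠ 0` for `c ≠ 0`, `d ≠ 0`: the hypothesis of `det_blockGram_ne_zero` in Markman's normalisation. [folklore] -/
theorem ne_zero_of_eq_mul_natCast [NeZero d] {a c : ℚ} (ha : a = c * d) (hc : c ≠ 0) : a ≠ 0 := by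
  rw [ha]
  exact mul_ne_zero hc (Nat.cast_ne_zero.2 (NeZero.ne d))

include hnd hα in
/-- **[Mar25 LEMMA 3.1.3] WITHOUT POSITIVITY — for every complex torus and every non-degenerate `η` (the printed proof's
computation; print states the lemma for the ample plane (2.4.5)).** For `X = E/Φ(ℤ^ι)`, `η ∈ NS(X)` non-degenerate
with integer Gram matrix `G` (ANY index: `±η` need not be a polarisation), `d ≥ 1`, any square root `α` of `-d` whose
matrix is Markman's `A = (0 (ᵗG)⁻¹; -d·ᵗG 0)` (it exists: `⟨A, weilMatrix_mul_self Φ hnd hG d⟩`, file XIIb∕c; for a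
polarised structure `h` of XIIe it is `h.sqrtNeg`), ANY rational `a, c` with `a = c·d`, `c ≠ 0` («up to a rational
scalar»), and ANY witnesses `hc'`, `hGt'`, `hdet'` of the three facts above (compatibility, alternation,
non-degeneracy — all PROVED for every `η`: `weilMatrix_compat_blockGram`, `transpose_blockGram`,
`det_blockGram_ne_zero`): the Hermitian form `H(x, y) = Γ(x, A y) + √-d·Γ(x, y)` of `(H₁(X × X̂, ℚ), K = ℚ(A))` for
`Γ = Γ(a, c) = (a·G 0; 0 c·(ᵗG)⁻¹)` — the rational Gram matrix of `c·Ξ_d` (file XIIe `map_ratCast_blockGram(_neg)`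
for `c = ±N`) — has **discriminant the class of `(-1)^{dim_ℂ X}` in `ℚˣ ⧸ Nm(Kˣ)`, in every `K`-basis `b`**: «Then the
discriminant of the hermitian form `H` is `(-1)ⁿ`.» (`det G = Pf(G)²` by the tree's `IsPolarizationType.det_latticeGram`
for a type of `η`, which exists for every non-degenerate `η ∈ NS(X)` — `IsNSForm.exists_isPolarizationType_of_nondegenerate`,
no positivity.) [cite: Markman2025SecantWeil, §3.1 Lemma 3.1.3] [cite: Lange2023AbelianVarietiesComplex, §7.3.3 Exercise (5)(c)]
[cite: vanGeemen1994HodgeAV, Lemma 5.2 (3)] -/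
theorem discr_hermForm_blockGram_weilMatrix [NeZero d] (hη : IsNSForm Φ η)
    (hG : G.map (Int.cast : ℤ → ℝ) = latticeGram Φ η) {a c : ℚ} (ha : a = c * d) (hc : c ≠ 0)
    (hc' : α.1ᵀ * Matrix.fromBlocks (a • G.map (Int.cast : ℤ → ℚ)) 0 0 (c • (G.transpose.map (Int.cast : ℤ → ℚ))⁻¹) *
        α.1 = (d : ℚ) • Matrix.fromBlocks (a • G.map (Int.cast : ℤ → ℚ)) 0 0 (c • (G.transpose.map (Int.cast : ℤ → ℚ))⁻¹))
    (hGt' : (Matrix.fromBlocks (a • G.map (Int.cast : ℤ → ℚ)) 0 0 (c • (G.transpose.map (Int.cast : ℤ → ℚ))⁻¹))ᵀ =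
        -Matrix.fromBlocks (a • G.map (Int.cast : ℤ → ℚ)) 0 0 (c • (G.transpose.map (Int.cast : ℤ → ℚ))⁻¹))
    (hdet' : (Matrix.fromBlocks (a • G.map (Int.cast : ℤ → ℚ)) 0 0 (c • (G.transpose.map (Int.cast : ℤ → ℚ))⁻¹)).det ≠ 0)
    {κ : Type*} [Fintype κ] [DecidableEq κ] (b : Module.Basis κ (RatSqrtNeg d) (WeilVec α)) :
    WeilHermitian.discr (isSymm_hermForm hc' hGt') (nondegenerate_hermForm hc' hdet').2 b =
      QuotientGroup.mk ((-1) ^ finrank ℂ E) := by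
  haveI : FiniteDimensional ℝ E := LinearEquiv.finiteDimensional Φ.toLinearEquiv
  haveI : FiniteDimensional ℂ E := Module.Finite.of_restrictScalars_finite ℝ ℂ E
  have hcard : Fintype.card ι = 2 * finrank ℂ E := card_eq_two_mul_finrank Φ
  -- `det G = Pf(G)²` (a polarisation TYPE exists for every non-degenerate `η ∈ NS(X)`; no positivity)
  have hnd' : ∀ v : E, v ≠ 0 → ∃ w : E, η ![v, w] ≠ 0 := fun v hv ↦ by
    by_contra h0
    push Not at h0
    exact hv (hnd v h0)
  obtain ⟨g', δ, hδ, -⟩ := hη.exists_isPolarizationType_of_nondegenerate Φ hnd'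
  have hdetQ : (G.map (Int.cast : ℤ → ℚ)).det = (∏ i, (δ i : ℚ)) ^ 2 := by
    apply Rat.cast_injective (α := ℝ)
    have h1 : (((G.map (Int.cast : ℤ → ℚ)).det : ℚ) : ℝ) = ((G.map (Int.cast : ℤ → ℚ)).map (Rat.cast : ℚ → ℝ)).det :=
      RingHom.map_det (Rat.castHom ℝ) _
    rw [h1, map_intCast_map_ratCast₃, hG, hδ.det_latticeGram]
    push_cast
    ring_nf
  have ha0 : a ≠ 0 := ne_zero_of_eq_mul_natCast ha hc
  have hC : ((-(d : ℚ)) • G.transpose.map (Int.cast : ℤ → ℚ)).det ≠ 0 := by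
    rw [Matrix.det_smul]
    exact mul_ne_zero (pow_ne_zero _ (neg_ne_zero.2 (Nat.cast_ne_zero.2 (NeZero.ne d))))
      (isUnit_det_transposeGram Φ hnd hG).ne_zero
  have hr : a ^ finrank ℂ E * ∏ i, (δ i : ℚ) ≠ 0 := by
    refine mul_ne_zero (pow_ne_zero _ ha0) fun h0 ↦ ?_
    apply (isUnit_det_map_intCast_gram Φ hnd hG).ne_zero
    rw [hdetQ, h0]
    ring
  have hG₁ : (a • G.map (Int.cast : ℤ → ℚ)).det = (a ^ finrank ℂ E * ∏ i, (δ i : ℚ)) ^ 2 := by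
    rw [Matrix.det_smul, hcard, hdetQ]
    ring
  exact discr_hermForm_blockGram (a • G.map (Int.cast : ℤ → ℚ)) (c • (G.transpose.map (Int.cast : ℤ → ℚ))⁻¹)
    (G.transpose.map (Int.cast : ℤ → ℚ))⁻¹ ((-(d : ℚ)) • G.transpose.map (Int.cast : ℤ → ℚ)) α hα hc' hGt' hdet' hC
    hcard hr hG₁ b

include hnd hα in
/-- **Hypothesis-free form: for EVERY non-degenerate `η ∈ NS(X)` — polarising or not — every `d ≥ 1` and every rational
scale `c ≠ 0`, Markman's Hermitian `K`-space `(H₁(X × X̂, ℚ), H_{Γ(c d, c)})` has discriminant `[(-1)^{dim_ℂ X}]`**, the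
three structural inputs being discharged by `weilMatrix_compat_blockGram`, `transpose_blockGram`, `det_blockGram_ne_zero`.
At an intermediate-index direction (`0 < s(η) < dim X`; e.g. sheet S3INP-4's `E⁴` class, XIId `hermIndex_Xi_eFour`) no
`IsPolarizedWeilType` structure exists for either orientation, yet the discriminant class is the same split class.
[cite: Markman2025SecantWeil, §3.1 Lemma 3.1.3] [cite: Lange2023AbelianVarietiesComplex, §7.3.3 Exercise (5)(c)] -/
theorem discr_hermForm_weilMatrix [NeZero d] (hη : IsNSForm Φ η) (hG : G.map (Int.cast : ℤ → ℝ) = latticeGram Φ η)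
    {a c : ℚ} (ha : a = c * d) (hc : c ≠ 0) {κ : Type*} [Fintype κ] [DecidableEq κ]
    (b : Module.Basis κ (RatSqrtNeg d) (WeilVec α)) :
    WeilHermitian.discr
        (isSymm_hermForm (weilMatrix_compat_blockGram Φ hnd α hα hG ha) (transpose_blockGram Φ hnd hG a c))
        (nondegenerate_hermForm (weilMatrix_compat_blockGram Φ hnd α hα hG ha)
          (det_blockGram_ne_zero Φ hnd hG (ne_zero_of_eq_mul_natCast ha hc) hc)).2 b =
      QuotientGroup.mk ((-1) ^ finrank ℂ E) :=
  discr_hermForm_blockGram_weilMatrix Φ hnd α hα hη hG ha hc (weilMatrix_compat_blockGram Φ hnd α hα hG ha)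
    (transpose_blockGram Φ hnd hG a c) (det_blockGram_ne_zero Φ hnd hG (ne_zero_of_eq_mul_natCast ha hc) hc) b

/-- **Consistency with file XIIe (the polarised case).** Whenever the tree's polarised-Weil-type structure
`h : IsPolarizedWeilType (X × X̂) E' A d n` EXISTS for a polarisation `E'` whose rational Gram matrix is `Γ(a, c)` —
by file XIId, for `E' = N·(±Ξ_d)` exactly when `±η` is a Riemann form — its `h.discriminant` (Lange §7.3.3 Exercise (5)(c);
XIIe `discriminant_smul_Xi` ∕ `discriminant_eq_of_blockGram`) IS the `discr` of this file's Hermitian form on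
`(H₁(X × X̂, ℚ), h.sqrtNeg)` in any `K`-basis and for any witnesses: the two forms coincide (`H(x, y) = E'(x, A y) + √-d E'(x, y)`
with the same Gram matrix). So XIIe is the special case «`±b` a polarisation» of `discr_hermForm_blockGram_weilMatrix`,
which covers the intermediate-index directions as well. [cite: Lange2023AbelianVarietiesComplex, §7.3.3 Exercise (5)(c)]
[cite: Markman2025SecantWeil, §3.1 Lemma 3.1.3] -/
theorem discriminant_eq_discr_hermForm [NeZero d] {a c : ℚ} {η' : (E × (E →L⋆[ℂ] ℂ)) [⋀^Fin 2]→L[ℝ] ℝ} {n : ℕ}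
    (h : IsPolarizedWeilType (prodPeriod Φ (dualPeriod Φ)) η'
        (Matrix.fromBlocks 0 (G.transpose.map (Int.cast : ℤ → ℚ))⁻¹ ((-(d : ℚ)) • G.transpose.map (Int.cast : ℤ → ℚ)) 0)
        d n)
    (hGq : (Matrix.fromBlocks (a • G.map (Int.cast : ℤ → ℚ)) 0 0 (c • (G.transpose.map (Int.cast : ℤ → ℚ))⁻¹)).map
        (Rat.cast : ℚ → ℝ) = latticeGram (prodPeriod Φ (dualPeriod Φ)) η')
    (hc' : h.sqrtNeg.1ᵀ * Matrix.fromBlocks (a • G.map (Int.cast : ℤ → ℚ)) 0 0 (c • (G.transpose.map (Int.cast : ℤ → ℚ))⁻¹) *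
        h.sqrtNeg.1 =
        (d : ℚ) • Matrix.fromBlocks (a • G.map (Int.cast : ℤ → ℚ)) 0 0 (c • (G.transpose.map (Int.cast : ℤ → ℚ))⁻¹))
    (hGt' : (Matrix.fromBlocks (a • G.map (Int.cast : ℤ → ℚ)) 0 0 (c • (G.transpose.map (Int.cast : ℤ → ℚ))⁻¹))ᵀ =
        -Matrix.fromBlocks (a • G.map (Int.cast : ℤ → ℚ)) 0 0 (c • (G.transpose.map (Int.cast : ℤ → ℚ))⁻¹))
    (hdet' : (Matrix.fromBlocks (a • G.map (Int.cast : ℤ → ℚ)) 0 0 (c • (G.transpose.map (Int.cast : ℤ → ℚ))⁻¹)).det ≠ 0)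
    {κ : Type*} [Fintype κ] [DecidableEq κ] (b : Module.Basis κ (RatSqrtNeg d) (WeilVec h.sqrtNeg)) :
    h.discriminant = WeilHermitian.discr (isSymm_hermForm hc' hGt') (nondegenerate_hermForm hc' hdet').2 b := by
  rw [← h.discr_eq_discriminant hGq b]
  rfl

end Markman

/-! ## §3 The lane's counter-model direction: `η₄ = e₁ + e₂ + e₃ − e₄` on `E_τ⁴` (index `1`, polarised for NEITHER orientation) -/

section EFour

variable {τ : ℂ} (hτ : 0 < τ.im)

/-- **The integer Gram matrix of `η₄ = (E ⊞ E) ⊞ (E ⊞ (−E))` on the lattice basis of `E_τ⁴` is `G₄ = ((J 0; 0 J) 0; 0 (J 0; 0 −J))`,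
`J = (0 1; −1 0)`** (file IVb: `det = 1`, `hermIndex η₄ = 1`, `∫ η₄⁴ = −24`).
[cite: Lange2023AbelianVarietiesComplex, §2.4.4 Cor. 2.4.24 and §2.1.1 Example 2.1.3] -/
theorem eFourGram_map_intCast :
    (Matrix.fromBlocks (Matrix.fromBlocks ellipticGram 0 0 ellipticGram) 0 0
        (Matrix.fromBlocks ellipticGram 0 0 (-ellipticGram))).map (Int.cast : ℤ → ℝ) =
      latticeGram (prodPeriod (prodPeriod (ellipticPeriod hτ.ne') (ellipticPeriod hτ.ne'))
          (prodPeriod (ellipticPeriod hτ.ne') (ellipticPeriod hτ.ne')))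
        (prodForm (prodForm (ellipticForm hτ.ne') (ellipticForm hτ.ne'))
          (prodForm (ellipticForm hτ.ne') (-ellipticForm hτ.ne'))) := by
  have hneg : latticeGram (ellipticPeriod hτ.ne') (-ellipticForm hτ.ne') =
      -latticeGram (ellipticPeriod hτ.ne') (ellipticForm hτ.ne') := by
    ext i j
    rw [Matrix.neg_apply, latticeGram_apply, latticeGram_apply, ContinuousAlternatingMap.neg_apply]
  rw [latticeGram_prod, latticeGram_prod, latticeGram_prod, hneg, ← ellipticGram_map_intCast hτ.ne']
  simp only [Matrix.fromBlocks_map, Matrix.map_zero _ Int.cast_zero,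
    Matrix.map_neg (Int.cast : ℤ → ℝ) (fun a ↦ Int.cast_neg a)]

/-- **THE INTERMEDIATE-INDEX CASE IS INHABITED (sheet S3INP-4 ∕ XIId `hermIndex_Xi_eFour`).** On `X = E_τ⁴` the secant direction
`η₄ = e₁ + e₂ + e₃ − e₄` has index `1` and `∫_X η₄⁴ = −24 < 0` ((H1) FAILS, file IVb); Markman's `Ξ_d = d·η₄ ⊞ η₄^*` has index
`2 ∉ {0, 8}`, so `(X × X̂, ±Ξ_d, A)` is a polarised complex torus of Weil type for NEITHER orientation (XIId) and file XIIe's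
discriminant theorem is EMPTY there. Nevertheless, for every `d ≥ 1`, every rational `a = c·d`, `c ≠ 0`, every square root `α` of `−d` over
Markman's `A = (0 (ᵗG₄)⁻¹; −d·ᵗG₄ 0)` and every `K`-basis: **the Hermitian `K`-space `(H₁(X × X̂, ℚ), H_{Γ(a,c)})` has discriminant
`[(-1)⁴] = 1 ∈ ℚˣ ⧸ Nm(Kˣ)`** — the split class, as printed («all have discriminat `(-1)^n`», here `n = 4`).
[cite: Markman2025SecantWeil, §3.1 Lemma 3.1.3] [cite: Lange2023AbelianVarietiesComplex, §7.3.3 Exercise (5)(c)] -/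
theorem discr_hermForm_weilMatrix_eFour {d : ℕ} [NeZero d]
    (α : SqrtNegMat (((Fin 2 ⊕ Fin 2) ⊕ (Fin 2 ⊕ Fin 2)) ⊕ ((Fin 2 ⊕ Fin 2) ⊕ (Fin 2 ⊕ Fin 2))) d)
    (hα : α.1 = Matrix.fromBlocks 0
        ((Matrix.fromBlocks (Matrix.fromBlocks ellipticGram 0 0 ellipticGram) 0 0
            (Matrix.fromBlocks ellipticGram 0 0 (-ellipticGram))).transpose.map (Int.cast : ℤ → ℚ))⁻¹
        ((-(d : ℚ)) • (Matrix.fromBlocks (Matrix.fromBlocks ellipticGram 0 0 ellipticGram) 0 0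
            (Matrix.fromBlocks ellipticGram 0 0 (-ellipticGram))).transpose.map (Int.cast : ℤ → ℚ)) 0)
    {a c : ℚ} (ha : a = c * d) (hc : c ≠ 0) {κ : Type*} [Fintype κ] [DecidableEq κ]
    (b : Module.Basis κ (RatSqrtNeg d) (WeilVec α)) :
    WeilHermitian.discr
        (isSymm_hermForm
          (weilMatrix_compat_blockGram _ (eq_zero_of_forall_eFour_apply_eq_zero hτ) α hα (eFourGram_map_intCast hτ) ha)
          (transpose_blockGram _ (eq_zero_of_forall_eFour_apply_eq_zero hτ) (eFourGram_map_intCast hτ) a c))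
        (nondegenerate_hermForm
          (weilMatrix_compat_blockGram _ (eq_zero_of_forall_eFour_apply_eq_zero hτ) α hα (eFourGram_map_intCast hτ) ha)
          (det_blockGram_ne_zero _ (eq_zero_of_forall_eFour_apply_eq_zero hτ) (eFourGram_map_intCast hτ)
            (ne_zero_of_eq_mul_natCast ha hc) hc)).2 b = 1 := by
  have key := discr_hermForm_weilMatrix _ (eq_zero_of_forall_eFour_apply_eq_zero hτ) α hα (isNSForm_eFour hτ)
    (eFourGram_map_intCast hτ) ha hc b
  have h4 : finrank ℂ ((ℂ × ℂ) × (ℂ × ℂ)) = 4 := by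
    simp only [Module.finrank_prod, Module.finrank_self]
  rw [h4, Even.neg_one_pow (by decide : Even 4), QuotientGroup.mk_one] at key
  exact key

end EFour

end SecantParity

end Summit.Ventures.HSemireg
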